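import Literature.NumberTheory.EllipticCurves.BurungaleSkinnerTianWan2024.GreenbergLFunctionSupersingularExistsPRE
import Literature.NumberTheory.EllipticCurves.Kobayashi2003.SignedSelmer
import Literature.NumberTheory.EllipticCurves.Kobayashi2003.SignedKatoDivisibility
import HarnessLib

/-!
# Burungale–Skinner–Tian–Wan (arXiv:2409.01350v2, PREPRINT), Part III §1.3.2 Prop. 1.18 + §2.2.3
# Prop. 2.7 + Part II §5.4.1 Prop. 5.19 (with Part I §2.2 (sspLcy), Thm. 2.16, Lemma (GorPer)): the
# TWO-VARIABLE SIGNED DESCENT PACKAGE at a supersingular prime — what the objects `ξ(X_∘(g/L))`,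
# `𝓛_p^∘(g/L)` of BSTW do for a consumer that only ever sees their characteristic ideal / their image on
# the cyclotomic line — as ONE explicitly labelled OPEN binder (claim-tagged; NEVER a fact), EXISTENTIAL
# over the two carriers, in the frame currency of the tree (`IsKatzMeasure₂`, `IsGreenbergLFunctionAnyRoot₂`,
# `XGr₂.charIdeal`, `IwasawaAlgebra₂.toUnr₂`, `UnrSeries₂.plus`) and the one-variable signed currency of
# the tree (`Kobayashi2003.SignedSelmerDualData`, `Kobayashi2003.IsSignedPAdicLFunction`)

Typer seat `bsd-wall-ty-1` (gen 8) of cell `bsd-wall` (run/shared/lean/pub/bsd-wall/), for route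
`SignedBaseChange` of the BSD summit, crux K2R‴ = item stmt-BirchSwinnertonDyer-20213
`SignedLowerDescentFromCommonFrame`, stub (P) `stub_productLowerDivisibility`; planner brief
`HOME/bsd-wall-ss/TYPING-BRIEF-2VAR-SIGNED-v1.md` (v1.1, bsd-wall-ss g3; director-bsd g9 ruling W-6
2026-08-27T11:10Z «FILE-TYPING now»). HONEST FRAMING: UNREFEREED preprint ⇒ an explicitly labelled OPEN
hypothesis (`def … : Prop`, `[claim: …, status: under-review]`), NEVER a theorem, NEVER a `[cite:]`-fact,
no `_holds`; nothing is asserted about any curve; nothing is booked. ZERO new notions: §1 is ONE binder;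
§2 is commutative algebra PROVED (how a consumer cancels the Greenberg function and descends to the
cyclotomic line).

## Why this shape (typer finding, recorded for the review)

The brief asks for CARRIERS (FILE A: BSTW's two-variable signed Selmer group `S_∘(g/L)` over the
`ℤ_p²`-tower, Part III §1.1.2 [p0069 L110–117], whose signed local condition `H¹_∘(L_w, 𝓜)` at `w ∣ p`
is the orthogonal complement of the kernel of the two-variable signed Coleman map `𝒞_∘` of Part II §5.1–5.2
[p0049 L120 – p0050 L17], after Büyükboduk–Lei / Loeffler–Zerbes IJNT 2014; FILE B: `𝓛_p^∘(g/L) =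
𝒞_∘(loc_p(𝓑𝓕^∘(g/L))) ∈ 𝓡`, §5.2 [p0050 L57–L73]) and then for the three facts F1–F3 over them. The
tree has neither the two-variable big logarithm nor Kim's `𝔭`-ray local tower (Lei–Palvannan, Forum
Math. Sigma 7 (2019) §6.1 [paper:arxiv-1806.07214 p0025 L48–p0026 L2]: `E^±(K(𝔭^m𝔮^n)_𝔓)` by trace
relations along the `𝔭`-conductor, then `Δ`-invariants), so a CONSTRUCTED carrier is out of reach this
shift, and a HYPOTHESIS-STRUCTURE carrier for the LOCAL CONDITION ITSELF would be under-determined (the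
tree's precedents `Kobayashi2003.SignedSelmerDualData` / `Rubin1991.DualData₂` are pinned to CONSTRUCTED
Selmer groups; an unpinned "signed submodule of `H¹(L_w, 𝓜)`" makes every `∀`-fact over it false for
the wrong reason — take the relaxed condition — and every `∃`-fact vacuous unless conjoined). What the
consumer (P) CONSUMES of `X_∘(g/L)`, `𝓛_p^∘(g/L)` is exactly: (P1) the Prop. 1.18 identity of ideals in
`Λ_L^ur`, (P2) Prop. 2.7's "in particular" on the cyclotomic line, (P3) Prop. 5.19 + (sspLcy) + the
one-variable period/sign dictionary on the cyclotomic line. So this file states «there EXIST an element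
`ξ_∘` (standing for `ξ(X_∘(g/L))`) and an element `𝓛^∘` (standing for `𝓛_p^∘(g/L)`) of
`𝒪_{ℂ_p}⟦T₁⟧⟦T₂⟧` with (P1) ∧ (P2) ∧ (P3)», for each sign. WEAKER-OR-EQUAL to print (print constructs
the two objects and proves the three properties); exactly as strong as (P) needs; when constructed carriers
land (items `defn-SignedSelmerTwoVariable`, `defn-SignedLFunctionTwoVariable`, facts wi-79743 / wi-79745
/ wi-79747 / wi-79749 of the W-6 filing) this binder becomes a THEOREM `…_of_carriers` over them (debt 0).

## The printed statements (store text `paper:arxiv-2409.01350` = the TeX in 3 000-char pages pNNNN)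

* Part III §1.1.2 [p0069 L92–L117]: "Let `L` be an imaginary quadratic field satisfying the conditions
  (ord) and (coprime), and so `(p) = v v̄` with `v` determined via the embedding `ι_p` … For `p ∤ 2N` a
  supersingular prime, define `S^·_∘(g/L) = ker{H¹(G_{L,Σ}, 𝓜^·) → ∏_{v∈Σ, v∤p} H¹(L_v, 𝓜^·) ×
  ∏_{w∣p} H¹(L_w, 𝓜^·)/H¹_∘(L_w, 𝓜^·)}` and let `X^·_∘(g/L)` denote its Pontryagin dual"
  (`· ∈ {∅, cyc, ac}`, `𝓜^· = T(1) ⊗ Λ_L^{·,∨}`). §2.2.11 [p0016 L20–23]: "supersingular" = `p ∤ N` and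
  `a_g(p) = 0`. §1.2.5 [p0014 L33–42]: (irr_K) "`T̄` is an absolutely irreducible `k_λ[G_K]`-module", which
  implies (van_M) "`T̄^{G_M} = 0`".
* **Prop. 1.18** [p0072 L1–L21]: "Let `g ∈ S₂(Γ₀(N))` be an elliptic newform and `p ∤ 2N` an ordinary or a
  supersingular prime. Let `L` be an imaginary quadratic field satisfying the conditions (ord), (coprime)
  and (van_L) … Then for `· ∈ {∅, cyc}` a one-sided divisibility in one of the Conjectures (St),
  (Greenberg) and (LLZ) implies the analogous divisibility in the other conjectures. … Without the
  condition (van_L), these assertions still hold in `Λ^·_{L,𝒪_λ} ⊗ ℚ_p`. … *Proof.* We present the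
  ordinary case assuming the hypothesis (van_L), and leave the supersingular case to the interested
  reader. To begin, the Poitou–Tate global duality … yields an exact sequence `0 → H¹_{rel,ord}/Λ·𝒵 →
  Im(H¹_ord(L_v̄))/Λ·loc_v̄(𝒵) → X_Gr(g/L) → X_{st,ord}(g/L) → 0`" and its signed twin (exv)/(exvc2); with
  Thm. (cycIwL)(b) [p0071 L40–52: "`ξ(H¹_{rel,•}/Λ·𝒵) = ξ(X_{st,•})` … in `Λ` if (van_L) holds"] and
  Prop. (2varZ-prop) both four-term sequences give `ξ(X_Gr)·(𝓛^∘_p) = ξ(X_∘)·(𝓛^Gr_p)` (the IDENTITY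
  FORM, product-friendly; proof-extracted ⇒ grade PRE-READER in the planner's census).
* **Prop. 2.7** [p0076 L20–L33]: "Let `g ∈ S₂(Γ₀(N))` be an elliptic newform and `p ∤ 2N` a supersingular
  prime. Let `L` be an imaginary quadratic field such that (ord) holds. Then we have `X_∘(g/L)/(γ_ac − 1)
  ≃ X^cyc_∘(g/L)`. In particular `ξ(X_∘(g/L)) mod (γ_ac − 1) ∣ ξ(X_∘(g))·ξ(X_∘(g ⊗ χ_L))`. … *Proof.* One
  may proceed as in the proof of [SU] (see also [Ko]). Note that 'In particular' part follows from
  supersingular analogue of the factorisation (sel-fac) (cf. [SU])" ((sel-fac) = Lemma 1.17's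
  `ξ(X^cyc(g/L)) = ξ(X(g))·ξ(X(g′))`, `g′ = g ⊗ χ_L`, `(D_L, N) = 1` [p0071 L97–L119]).
* **Prop. 5.19** [p0054 L138 – p0055 L12]: "Let `g′ = g ⊗ χ_L`. Let `0 ≠ ω ∈ S_{F,g}`, and let
  `γ ∈ V_{F,g}` and `γ′ ∈ V_{F,g′}`. (i) `𝓛_p^∘(g/L) mod (γ_v − 1) = c^∘(ω,γ,γ′) 𝔤(χ_L)⁻¹
  𝓛^∘_{ω,γ,γ′}(g/L) ∈ Λ_{𝒪_λ} = 𝓡/(γ_v − 1)𝓡`, (ii) if (irr_ℚ) holds, `ω ∈ S_{g,𝒪}` is good, and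
  `γ ∈ T_{g,𝒪}` and `γ′ ∈ T_{g′,𝒪}` are such that `γ^±` is an `𝒪`-basis of `T^±_{𝒪,g}` and `(γ′)^±` is an
  `𝒪`-basis of `T^±_{𝒪,g′}`, then `c^∘(ω,γ,γ′) ∈ 𝒪^×`. In part (i), `𝓛^∘_{ω,γ,γ′}(g/L)` is the cyclotomic
  `p`-adic `L`-function for `g` over `L` as in Section (sspLcy)"; §2.3 [p0076 L45–L47]: "Recall that
  `𝓛_p^{∘,cyc}(g/L) = 𝓛_γ(g)·𝓛_{γ′}(g′)` for `g′ = g ⊗ χ_L`, and `γ, γ′` as in Lemma (GorPer)"; §5.1.1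
  footnote [p0049 L59]: "While our labelling of signs is opposite to [Po], it is consistent with the
  formulation of main conjectures in [Ko]" — i.e. BSTW's `∘` IS Kobayashi's sign = the tree's `ε`
  (`Kobayashi2003.IsSignedPAdicLFunction f p ε`: Kobayashi's labelling of Pollack's functions, normalised
  by the period `Ω⁺_f` of the newform through `ratPlusSymbol`; Thm. 2.16 [p0025 L44–L70]: `e_p^+ = 2`,
  `e_p^- = p − 1` at the trivial character, as Kobayashi's (3.6)).

## Transcription (elliptic-curve instance `g = f_E`, `L = K`, `𝒪_λ = ℤ_p`; frame currency VERBATIM that of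
## `TwistPairGreenbergProductDivisibilitySplit` (K1′, stmt-20502) and of `thm617_…_supersingular_PRE`)

BINDERS: `W/ℚ` globally minimal, `f` its newform at level `N = N_E`; `p` odd, `p ∤ N_E`, `a_p(E) = 0`
("`p ∤ 2N` supersingular"); `K` imaginary quadratic, (ord) `#primesOver p = 2` with `p ∈ v`, `p ∈ v̄`,
`v̄ ≠ v`, `v` induced by `ι`; (coprime) `IsCoprime N D_K`; (irr_K) in K1′'s spelling (every mod-`p`
representation realising `E[p]|_{G_K}` is absolutely irreducible — implies (van_K) of Prop. 1.18 and
(irr_ℚ) of Prop. 5.19 (ii)); the `ℤ_p²`-tower `(κ₁, κ₂)` = (cyclotomic, anticyclotomic) with an adapted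
generator pair `(γ₁, γ₂)` (receptacle `𝒪_{ℂ_p}⟦T₁⟧⟦T₂⟧ = PowerSeries (PowerSeries 𝒪)`, OUTER `T₁ =
γ₁ − 1` cyclotomic, INNER `T₂ = γ₂ − 1` anticyclotomic — so "mod `(γ_ac − 1)`" IS `UnrSeries₂.plus`,
killing the inner variable, exactly the map of `YanZhu2026` §3.5 / Cor. 5.4 (`plus_toUnr₂`, `plus_mul`);
BSTW's own coordinates `𝓡 = ℤ_p⟦Γ_L^v × Γ⟧`, "mod `(γ_v − 1)`" in Prop. 5.19, name the SAME line);
a Katz frame `(Ω, δ, Ω_p, LK)` and a series `G` in the Greenberg frame of `f` over it (`IsKatzMeasure₂ …`,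
`IsGreenbergLFunctionAnyRoot₂ …`, VERBATIM K1′); a structure map `J : ℤ_p → 𝒪_{ℂ_p}` with its
compatibility clause (VERBATIM K1′); a sign `ε : ℤˣ` in KOBAYASHI's labelling.
CONCLUSION: there are `ξ_∘, 𝓛^∘ ∈ 𝒪_{ℂ_p}⟦T₁⟧⟦T₂⟧` with
* (P1) `(ξ_∘ · G) = Char(X_Gr(E/K_∞))·𝒪⟦T₁,T₂⟧ · (𝓛^∘)` as ideals — Prop. 1.18 in identity form;
* on the cyclotomic line, for every cyclotomic datum `(κ, γ)` over `ℚ` in the CANONICAL variable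
  (`IsCyclotomicVariable p γ`, the variable of the tree's Pollack functions and Mazur–Tate elements) that
  MATCHES `γ₁` modulo torsion of `ℤ_p^×` (so `T₁ = T` under `Gal(K_∞^cyc/K) ≅ Gal(ℚ_∞/ℚ)`), and every
  globally minimal model `W₂` of the twist `E^{(D_K)}` (the curve of `g′ = g ⊗ χ_K`):
  (P2) `plus ξ_∘ ∣ J(g₁ · g₂)` for all generators `g₁` of `Char X^ε(E/ℚ_∞)` and `g₂` of
  `Char X^ε(E^{(D_K)}/ℚ_∞)` (`Kobayashi2003.SignedSelmerDualData … ε`) — Prop. 2.7 "in particular";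
  (P3) `plus 𝓛^∘ = u · J(L₁ · L₂)` for a UNIT `u` of `𝒪_{ℂ_p}⟦T⟧`, for Kobayashi's `L^ε` of `f` and of the
  newform `f₂` of `W₂` (`Kobayashi2003.IsSignedPAdicLFunction … ε`) — Prop. 5.19 (i)+(ii) with (sspLcy)
  and the [BSTW]/[Po]/[Ko] period–sign dictionary (`c^∘ ∈ 𝒪^×`, `𝔤(χ_K)` a unit since `p ∤ D_K`, the
  canonical-period ratios `Ω_{ω,γ}/Ω^±_f` units under (irr_ℚ): Lemma (GorPer) [p0015], Remark
  (EC-optperiod) [p0017 L41]) ABSORBED into `u` — WEAKER than print, which gives a unit CONSTANT.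

READING FLAGS (cell readings, NOT in print; why the binder is claim-tagged twice over).
`BSTW-2VS-frame`: print constructs ONE pair `(𝓛_v(L), 𝓛_p^Gr(g/L))` (Thm. 4.19, §6.4); the binder is read
over EVERY typed frame `(LK, G)`, exactly as K1′ (stmt-20502) reads its Greenberg inclusion — two inhabited
typed frames for the same field data differ by a unit of `𝒪_{ℂ_p}⟦T₁,T₂⟧` (a continuous period rescaling
`(1+T₁)^a (1+T₂)^b · c`), under which (P1)–(P3) are invariant. `BSTW-2VS-signs`: print proves everything
for both of ITS signs `∘ ∈ {+, −}`; the binder is stated for each Kobayashi sign `ε` with BOTH the Selmer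
side (P2) and the `L`-side (P3) in Kobayashi's labelling, so the [BSTW]/[Ko] dictionary (a bijection of
`{+, −}` — the identity by the §5.1.1 footnote p0049 L59; brief delicate point (iv): BSTW's `S_∘(g)` =
Kobayashi's `Sel^{±}`, its local condition being the annihilator of `E^±` under local Tate duality) is
absorbed whichever way it goes. `BSTW-2VS-XGr`: `XGr₂` is the tree's `X_Gr(E/K̃_∞)` with the inherited
reading flag `BCS-2VAR-away-p` of `TwoVariableSelmerDual.lean` (unramified-away-from-`p` vs full local
condition at `Σ`; same object as in K1′). `BSTW-2VS-coords`: the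
cyclotomic-line clauses bind only cyclotomic data `(κ, γ)` over `ℚ` matching `γ₁` modulo torsion; a
consumer whose `γ₁` is not in the canonical class (`χ_cyc(γ₁) ∉ (1 + p^{e₀})·μ`) gets (P1) only — the
route's frame item should carry "`γ₁` canonical" (cheap), or a generator-change lemma is owed.
`BSTW-2VS-reader`: Prop. 1.18's supersingular case is "left to the interested reader" [p0072 L21];
Prop. 2.7's proof is "as in [SU] (see also [Ko])".

WHAT IS NOT CLAIMED: no carrier is constructed or named; no torsion-ness of `X_∘(g/L)`; nothing at
`p = 2`, nothing for `a_p ≠ 0`, nothing for `(D_K, N) ≠ 1` or `p` non-split; no `_holds`. §2 proves only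
ring identities.

## References
* [BurungaleSkinnerTianWan2024] A. Burungale, C. Skinner, Y. Tian, X. Wan, *Zeta elements for elliptic
  curves and applications*, arXiv:2409.01350v2 (PREPRINT): Part III §1.1.2 (p0069), Prop. 1.18 (p0072),
  Thm. (cycIwL) (p0071), Lemma 1.17 (p0071), Prop. 2.7 and §2.3 (p0076), Prop. 5.19 (p0054–p0055), §5
  footnote on signs (p0049 L59), Part I §2.2 (sspLcy), Thm. 2.16, Lemma (GorPer) (p0015), Rem.
  (EC-optperiod) (p0017).
* [LeiPalvannan2018] A. Lei, B. Palvannan, Forum Math. Sigma 7 (2019) e25 = arXiv:1806.07214, §6.1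
  (Kim's doubly-signed Selmer groups — the carriers NOT constructed here).
* [Kobayashi2003] Invent. Math. 152 (2003): Def. 1.1, Thm. 3.2, (3.4)–(3.6) — tree `Kobayashi2003/*`.
* Tree: `BurungaleSkinnerTianWan2024/GreenbergLFunctionSupersingularExistsPRE.lean` (`thm617_…_PRE`, the
  frame currency), `YanZhu2026/GreenbergMainTheorems.lean` (`IwasawaAlgebra₂.toUnr₂`, `UnrSeries₂.plus`),
  `TwoVariableSelmerDual.lean` (`XGr₂.charIdeal`), `PAdicBSD.lean` (`IsCyclotomicVariable`),
  `Summits/…/Theses/SignedBaseChange.lean` (K1′ stmt-20502, K2R‴ stmt-20213 — NOT imported).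
-/

noncomputable section

open scoped Classical

open NumberField IsDedekindDomain Field CongruenceSubgroup
  Literature.NumberTheory.GaloisRepresentations Literature.NumberTheory.EllipticCurves
  Literature.NumberTheory.EllipticCurves.ModularForms

namespace Literature.NumberTheory.EllipticCurves.BurungaleSkinnerTianWan2024

/-! ### §1. The binder -/

/-- **OPEN HYPOTHESIS — UNREFEREED PREPRINT (arXiv:2409.01350v2), Prop. 1.18 (identity form,
supersingular case) ∧ Prop. 2.7 ("in particular") ∧ Prop. 5.19 (i)+(ii) with (sspLcy) and the
one-variable period/sign dictionary — the two-variable signed descent package, EXISTENTIAL over the two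
carriers.** For `E/ℚ` (globally minimal `W`, newform `f` of level `N = N_E`), an odd prime `p ∤ N_E` with
`a_p(E) = 0`, an imaginary quadratic `K` with `p = v v̄` split (`v` induced by `ι`), `(N, D_K) = 1` and
(irr_K), the cyclotomic/anticyclotomic `ℤ_p²`-tower `(κ₁, κ₂; γ₁, γ₂)`, every Katz frame `(Ω, δ, Ω_p, LK)`
with a Greenberg series `G` of `f` over it, every structure map `J`, and each Kobayashi sign `ε`: there
are `ξ_∘, 𝓛^∘ ∈ 𝒪_{ℂ_p}⟦T₁⟧⟦T₂⟧` such that (P1) `(ξ_∘ · G) = Char(X_Gr(E/K_∞))^{ur} · (𝓛^∘)`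
("`ξ(X_∘(g/L))·(𝓛^Gr_p(g/L)) = ξ(X_Gr(g/L))·(𝓛^∘_p(g/L))`", the two Poitou–Tate sequences of the proof
of Prop. 1.18 — supersingular case "left to the interested reader"), and, on the cyclotomic line
(`UnrSeries₂.plus` = "mod `(γ_ac − 1)`"), for every canonical cyclotomic datum `(κ, γ)` over `ℚ`
matching `γ₁` modulo torsion and every globally minimal model `W₂` of `E^{(D_K)}`: (P2)
`plus ξ_∘ ∣ J(g₁ g₂)` for all generators of `Char X^ε(E/ℚ_∞)`, `Char X^ε(E^{(D_K)}/ℚ_∞)` ("`ξ(X_∘(g/L))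
mod (γ_ac − 1) ∣ ξ(X_∘(g))·ξ(X_∘(g ⊗ χ_L))`", Prop. 2.7), (P3) `plus 𝓛^∘ = u · J(L₁ L₂)`, `u` a unit,
for Kobayashi's `L^ε` of `f` and of the newform of `W₂` ("`𝓛_p^∘(g/L) mod (γ_v − 1) = c^∘ 𝔤(χ_L)⁻¹
𝓛^∘_{ω,γ,γ′}(g/L)`, `c^∘ ∈ 𝒪^×` under (irr_ℚ), `𝓛^{∘,cyc}_p(g/L) = 𝓛_γ(g)·𝓛_{γ′}(g′)`", Prop. 5.19, §2.3;
sign labels = [Ko]'s = the tree's `ε`, §5.1.1 footnote; the period units `Ω⁺_f/Ω⁺_{ω,γ}` (optimal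
periods: p0014 L104–L134, Lemma 1.6 p0015 L90–L96) and `𝔤(χ_K)` (`p ∤ D_K`) absorbed into `u` — WEAKER than print).
READING FLAGS `BSTW-2VS-frame` / `-signs` / `-coords` / `-reader` of the module docstring. Stated for the
consumer K2R‴ (stmt-BirchSwinnertonDyer-20213) in the frame currency of K1′ (stmt-20502) VERBATIM. NEVER
cite this `Prop` as a theorem.
[claim: BurungaleSkinnerTianWan2024, status: under-review]
[cite: BurungaleSkinnerTianWan2024, Prop. 1.18 with its proof (Part III §1.3.2; arXiv v2 TeX store p0072 L1–L40) and Thm. (cycIwL)(b) (p0071 L40–52); Prop. 2.7 (§2.2.3, p0076 L20–L33) with Lemma 1.17 (sel-fac) (p0071 L97–L119); Prop. 5.19 (§5.4.1, p0054 L138–p0055 L12) with §2.3 (p0076 L45–L47), §5 footnote (p0049 L59), Lemma (GorPer) (p0015) (ANNOUNCED, OPEN binder)] -/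
def props118_27_519_exists_signedTwoVariablePackage_supersingular_PRE : Prop :=
  ∀ {p : ℕ} [Fact p.Prime] (ι : PadicAlgCl p ≃+* ℂ) (W : WeierstrassCurve ℚ) [W.IsElliptic]
    [W.IsGloballyMinimal] (K : Type) [Field K] [NumberField K] (v vbar : HeightOneSpectrum (𝓞 K))
    (κ₁ κ₂ : ZpExtension K p) (γ₁ γ₂ : absoluteGaloisGroup K)
    [Fact (ZpExtension.IsTopGeneratorPair κ₁ κ₂ γ₁ γ₂)] {N : ℕ} [NeZero N] (f : CuspForm (Gamma0 N) 2)
    [NeZero (NumberField.discr K).natAbs],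
    -- `g = f_E` of level `N = N_E`; `p ∤ 2N` supersingular: `p` odd, `p ∤ N_E`, `a_p(E) = 0`
    IsNewformOf W f → (N : ℤ) = W.conductorNorm ℤ → p ≠ 2 → ¬ (p : ℤ) ∣ W.conductorNorm ℤ →
    W.frobeniusTrace p = 0 →
    -- `L = K` imaginary quadratic; (ord) `p = v v̄` split, `v` induced by `ι`; (coprime) `(N, D_K) = 1`
    IsImaginaryQuadratic K → ((Ideal.span {(p : ℤ)}).primesOver (𝓞 K)).ncard = 2 →
    ((p : ℕ) : 𝓞 K) ∈ v.asIdeal → ((p : ℕ) : 𝓞 K) ∈ vbar.asIdeal → vbar ≠ v →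
    (∀ (w : InfinitePlace K) (k : 𝓞 K), k ∈ v.asIdeal ↔ ‖ι.symm (w.embedding (k : K))‖ < 1) →
    IsCoprime (N : ℤ) (NumberField.discr K) →
    -- (irr_K), K1′'s spelling (⇒ (van_K) of Prop. 1.18, (irr_ℚ) of Prop. 5.19 (ii))
    (∀ ρ : ModPGaloisRep K (ZMod p) 2, (W.baseChange K).IsTorsionGaloisRep p ρ →
      FramedRep.IsAbsolutelyIrreducible ρ) →
    -- the `ℤ_p²`-tower: `κ₁` cyclotomic (outer variable `T₁`), `κ₂` anticyclotomic (inner `T₂`)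
    κ₁.IsCyclotomic → κ₂.IsAnticyclotomic →
    -- a Katz frame and a Greenberg series `G = 𝓛_p^Gr(f/K)` over it (VERBATIM K1′ / `thm617_…_PRE`)
    ∀ (Ω δ : ℂ) (Ωp : (unrIntegers p)ˣ) (LK G : PowerSeries (PowerSeries (PadicComplexInt p))),
      Ω ≠ 0 → (δ ^ 2 = (NumberField.discr K : ℂ) ∨ δ ^ 2 = -(NumberField.discr K : ℂ)) →
      IsKatzMeasure₂ ι v vbar ∅ κ₁ κ₂ γ₁⁻¹ γ₂⁻¹ 1 Ω δ ((Ωp : unrIntegers p) : PadicComplex p) LK →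
      IsGreenbergLFunctionAnyRoot₂ ι v vbar κ₁ κ₂ γ₁⁻¹ γ₂⁻¹ f (NumberField.discr K).natAbs
        (NumberField.classNumber K) LK G →
    -- a structure map `J : ℤ_p → 𝒪_{ℂ_p}` with its compatibility clause (VERBATIM K1′)
    ∀ J : ℤ_[p] →+* PadicComplexInt p,
      (∀ x : ℤ_[p], ((J x : PadicComplexInt p) : PadicComplex p) = ((x : ℚ_[p]) : PadicComplex p)) →
    -- a sign, in KOBAYASHI's labelling
    ∀ ε : ℤˣ,
    ∃ xi Lsig : PowerSeries (PowerSeries (PadicComplexInt p)),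
      -- (P1) Prop. 1.18, identity form: `(ξ_∘ · 𝓛^Gr) = Char(X_Gr)^{ur} · (𝓛^∘)`
      Ideal.span {xi * G} =
          (WeierstrassCurve.XGr₂.charIdeal (W.baseChange K) p κ₁ κ₂ vbar γ₁ γ₂).map
              (IwasawaAlgebra₂.toUnr₂ p J) * Ideal.span {Lsig} ∧
      -- the cyclotomic line: a canonical cyclotomic datum `(κ, γ)` over `ℚ` matching `γ₁` mod torsion,
      -- and a globally minimal model `W₂` of the twist `E^{(D_K)}` (the curve of `g′ = g ⊗ χ_K`)
      ∀ (κ : ZpExtension ℚ p) (γ : absoluteGaloisGroup ℚ), κ.IsCyclotomic → κ.IsTopGenerator γ →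
        IsCyclotomicVariable p γ →
        (∃ ζ : ℤ_[p]ˣ, IsOfFinOrder ζ ∧
          GaloisRep.cyclotomicCharacter ℚ p γ * ζ = GaloisRep.cyclotomicCharacter K p γ₁) →
        ∀ (W₂ : WeierstrassCurve ℚ) [W₂.IsElliptic] [W₂.IsGloballyMinimal]
          (C₂ : WeierstrassCurve.VariableChange ℚ),
          C₂ • W₂ = W.quadraticTwist (NumberField.discr K : ℚ) →
          -- (P2) Prop. 2.7 "in particular": `ξ_∘ mod (γ_ac − 1) ∣ ξ(X^ε(E/ℚ_∞)) · ξ(X^ε(E^{(D_K)}/ℚ_∞))`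
          (∀ (D₁ : Kobayashi2003.SignedSelmerDualData W κ γ ε)
              (D₂ : Kobayashi2003.SignedSelmerDualData W₂ κ γ ε) (g₁ g₂ : IwasawaAlgebra p),
              D₁.charIdeal = Ideal.span {g₁} → D₂.charIdeal = Ideal.span {g₂} →
              UnrSeries₂.plus xi ∣ PowerSeries.map J (g₁ * g₂)) ∧
          -- (P3) Prop. 5.19 + (sspLcy) + dictionary: `𝓛^∘ mod (γ_ac − 1) = u · L^ε(f) · L^ε(f₂)`
          (∀ {N₂ : ℕ} [NeZero N₂] (f₂ : CuspForm (Gamma0 N₂) 2), IsNewformOf W₂ f₂ →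
            ∀ (L₁ L₂ : IwasawaAlgebra p), Kobayashi2003.IsSignedPAdicLFunction f p ε L₁ →
              Kobayashi2003.IsSignedPAdicLFunction f₂ p ε L₂ →
              ∃ u : PowerSeries (PadicComplexInt p), IsUnit u ∧
                UnrSeries₂.plus Lsig = u * PowerSeries.map J (L₁ * L₂))

/-! ### §2. How a consumer uses it: cancel the Greenberg function, descend to the cyclotomic line
(commutative algebra, PROVED; the shape of BSTW §2.3 "Proof of Theorem (KoMC_r)", p0076 L36–L65) -/

section Algebra

variable {R : Type*} [CommRing R]

/-- **Cancellation of the Greenberg functions in the product identity** (the step "(KoMC'_lb)" of §2.3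
run on a PAIR of newforms with only the PRODUCT Greenberg inclusion available, as in K2R‴): in a domain,
from `(ξ G) = I·(L)`, `(ξ′ G′) = I′·(L′)` and `I·I′ ≤ (G G′)` with `G G′ ≠ 0` one gets
`L L′ ∣ ξ ξ′`. [cite: BurungaleSkinnerTianWan2024, §2.3 proof of Thm. (KoMC_r) (arXiv v2 TeX store p0076 L45–L52) (the algebra of the step, for a pair)] -/
theorem mul_dvd_mul_of_span_mul_eq_of_le_span [IsDomain R] {ξ ξ' G G' L L' : R} {I I' : Ideal R}
    (h : Ideal.span {ξ * G} = I * Ideal.span {L}) (h' : Ideal.span {ξ' * G'} = I' * Ideal.span {L'})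
    (hle : I * I' ≤ Ideal.span {G * G'}) (hG : G * G' ≠ 0) : L * L' ∣ ξ * ξ' := by
  have hmem : ξ * G * (ξ' * G') ∈ I * I' * Ideal.span {L * L'} := by
    have h1 : ξ * G ∈ I * Ideal.span {L} := h ▸ Ideal.mem_span_singleton_self _
    have h2 : ξ' * G' ∈ I' * Ideal.span {L'} := h' ▸ Ideal.mem_span_singleton_self _
    have := Ideal.mul_mem_mul h1 h2
    have heq : I * Ideal.span {L} * (I' * Ideal.span {L'}) = I * I' * Ideal.span {L * L'} := by
      rw [← Ideal.span_singleton_mul_span_singleton]; ring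
    exact heq ▸ this
  have hmem' : ξ * G * (ξ' * G') ∈ Ideal.span {G * G'} * Ideal.span {L * L'} :=
    Ideal.mul_mono_left hle hmem
  rw [Ideal.span_singleton_mul_span_singleton, Ideal.mem_span_singleton] at hmem'
  obtain ⟨t, ht⟩ := hmem'
  refine ⟨t, mul_left_cancel₀ hG ?_⟩
  calc G * G' * (ξ * ξ') = ξ * G * (ξ' * G') := by ring
    _ = G * G' * (L * L') * t := ht
    _ = G * G' * (L * L' * t) := by ring

/-- The one-newform version: `(ξ G) = I·(L)` and `I ≤ (G)` with `G ≠ 0` give `L ∣ ξ` (the transfer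
"(Greenberg) ⇒ (St)/(LLZ) one-sided divisibility" of Prop. 1.18 in the identity reading). [cite: BurungaleSkinnerTianWan2024, Prop. 1.18 (arXiv v2 TeX store p0072 L14–L17) (the algebra of the transfer)] -/
theorem dvd_of_span_mul_eq_of_le_span [IsDomain R] {ξ G L : R} {I : Ideal R}
    (h : Ideal.span {ξ * G} = I * Ideal.span {L}) (hle : I ≤ Ideal.span {G}) (hG : G ≠ 0) : L ∣ ξ := by
  have hmem : ξ * G ∈ Ideal.span {G} * Ideal.span {L} :=
    Ideal.mul_mono_left hle (h ▸ Ideal.mem_span_singleton_self _)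
  rw [Ideal.span_singleton_mul_span_singleton, Ideal.mem_span_singleton] at hmem
  obtain ⟨t, ht⟩ := hmem
  refine ⟨t, mul_left_cancel₀ hG ?_⟩
  calc G * ξ = ξ * G := mul_comm _ _
    _ = G * L * t := ht
    _ = G * (L * t) := mul_assoc _ _ _

/-- **Descent to the cyclotomic line** (the step "Theorem (KoMC'_lb) in combination with Proposition
(ctl_st) implies `𝓛_γ(g)·𝓛_{γ′}(g′) ∣ ξ(X_∘(g))·ξ(X_∘(g′))`" of §2.3, for a pair, through a ring map `π`
such as `UnrSeries₂.plus`): from `L L′ ∣ ξ ξ′`, the images `π ξ ∣ a`, `π ξ′ ∣ a′` (P2) and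
`π L = u b`, `π L′ = u′ b′` with units `u, u′` (P3), one gets `b b′ ∣ a a′`. [cite: BurungaleSkinnerTianWan2024, §2.3 proof of Thm. (KoMC_r) (arXiv v2 TeX store p0076 L45–L52) (the algebra of the descent, for a pair)] -/
theorem mul_dvd_mul_of_map_of_dvd_of_eq_unit_mul {S : Type*} [CommRing S] (π : R →+* S)
    {ξ ξ' L L' : R} {a a' b b' u u' : S} (hdvd : L * L' ∣ ξ * ξ') (ha : π ξ ∣ a) (ha' : π ξ' ∣ a')
    (hu : IsUnit u) (hu' : IsUnit u') (hb : π L = u * b) (hb' : π L' = u' * b') :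
    b * b' ∣ a * a' := by
  have h1 : π L * π L' ∣ π ξ * π ξ' := by
    rw [← map_mul, ← map_mul]; exact map_dvd π hdvd
  have h3 : u * u' * (b * b') ∣ a * a' := by
    have hprod : π L * π L' = u * u' * (b * b') := by rw [hb, hb']; ring
    rw [← hprod]; exact h1.trans (mul_dvd_mul ha ha')
  exact (hu.mul hu').mul_left_dvd.mp h3

end Algebra


/-! ### §3. Consumability: the pair descent to the cyclotomic line from the binder (PROVED; the
two-variable ⇒ cyclotomic content of K2R‴'s `stub_transferDescent`, modulo the Greenberg-side
de-localisation D2′ and the final `𝒪_{ℂ_p}⟦T⟧ → ℤ_p⟦T⟧` descent of divisibility) -/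

section Consumability

/-- **Pair descent from the package** (BSTW §2.3 run on a pair of newforms `f, f′` over ONE Katz frame,
with only the slack-free PRODUCT Greenberg inclusion `Char(X_Gr(E/K_∞))^{ur}·Char(X_Gr(E′/K_∞))^{ur} ≤
(G·G′)` available — K1′ after D2′): granted the binder, for each Kobayashi sign `ε`, every canonical
cyclotomic datum `(κ, γ)` over `ℚ` matching `γ₁`, globally minimal models `W₂`, `W₄` of the
`D_K`-twists of `E`, `E′`, signed dual data `D₁, …, D₄` of `E, E^{(D_K)}, E′, E′^{(D_K)}` with generators
`g₁, …, g₄`, and Kobayashi `L^ε`-functions `L₁, …, L₄` of their newforms: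
`J(L₁L₂)·J(L₃L₄) ∣ J(g₁g₂)·J(g₃g₄)` in `𝒪_{ℂ_p}⟦T⟧` (the four-curve product lower divisibility on the
cyclotomic line, before descent to `ℤ_p⟦T⟧`). Every binder of the package is instantiated — a T2
(dead-binder) certificate for the typing. [cite: BurungaleSkinnerTianWan2024, §2.3 proof of Thm. (KoMC_r) (arXiv v2 TeX store p0076 L36–L65) with Props. 1.18, 2.7, 5.19 (shape; nothing asserted)] -/
theorem map_mul_dvd_map_mul_of_package
    (hP : props118_27_519_exists_signedTwoVariablePackage_supersingular_PRE)
    {p : ℕ} [Fact p.Prime] (ι : PadicAlgCl p ≃+* ℂ) (W W' : WeierstrassCurve ℚ) [W.IsElliptic]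
    [W.IsGloballyMinimal] [W'.IsElliptic] [W'.IsGloballyMinimal] (K : Type) [Field K] [NumberField K]
    (v vbar : HeightOneSpectrum (𝓞 K)) (κ₁ κ₂ : ZpExtension K p) (γ₁ γ₂ : absoluteGaloisGroup K)
    [Fact (ZpExtension.IsTopGeneratorPair κ₁ κ₂ γ₁ γ₂)] {N N' : ℕ} [NeZero N] [NeZero N']
    (f : CuspForm (Gamma0 N) 2) (f' : CuspForm (Gamma0 N') 2) [NeZero (NumberField.discr K).natAbs]
    (hf : IsNewformOf W f) (hN : (N : ℤ) = W.conductorNorm ℤ) (hf' : IsNewformOf W' f')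
    (hN' : (N' : ℤ) = W'.conductorNorm ℤ) (hp : p ≠ 2) (hpN : ¬ (p : ℤ) ∣ W.conductorNorm ℤ)
    (hpN' : ¬ (p : ℤ) ∣ W'.conductorNorm ℤ) (hap : W.frobeniusTrace p = 0) (hap' : W'.frobeniusTrace p = 0)
    (hK : IsImaginaryQuadratic K) (hsplit : ((Ideal.span {(p : ℤ)}).primesOver (𝓞 K)).ncard = 2)
    (hv : ((p : ℕ) : 𝓞 K) ∈ v.asIdeal) (hvbar : ((p : ℕ) : 𝓞 K) ∈ vbar.asIdeal) (hne : vbar ≠ v)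
    (hι : ∀ (w : InfinitePlace K) (k : 𝓞 K), k ∈ v.asIdeal ↔ ‖ι.symm (w.embedding (k : K))‖ < 1)
    (hcop : IsCoprime (N : ℤ) (NumberField.discr K)) (hcop' : IsCoprime (N' : ℤ) (NumberField.discr K))
    (hirr : ∀ ρ : ModPGaloisRep K (ZMod p) 2, (W.baseChange K).IsTorsionGaloisRep p ρ →
      FramedRep.IsAbsolutelyIrreducible ρ)
    (hirr' : ∀ ρ : ModPGaloisRep K (ZMod p) 2, (W'.baseChange K).IsTorsionGaloisRep p ρ →
      FramedRep.IsAbsolutelyIrreducible ρ)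
    (hcyc : κ₁.IsCyclotomic) (hanti : κ₂.IsAnticyclotomic)
    {Ω δ : ℂ} {Ωp : (unrIntegers p)ˣ} {LK G G' : PowerSeries (PowerSeries (PadicComplexInt p))}
    (hΩ : Ω ≠ 0) (hδ : δ ^ 2 = (NumberField.discr K : ℂ) ∨ δ ^ 2 = -(NumberField.discr K : ℂ))
    (hLK : IsKatzMeasure₂ ι v vbar ∅ κ₁ κ₂ γ₁⁻¹ γ₂⁻¹ 1 Ω δ ((Ωp : unrIntegers p) : PadicComplex p) LK)
    (hG : IsGreenbergLFunctionAnyRoot₂ ι v vbar κ₁ κ₂ γ₁⁻¹ γ₂⁻¹ f (NumberField.discr K).natAbs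
      (NumberField.classNumber K) LK G)
    (hG' : IsGreenbergLFunctionAnyRoot₂ ι v vbar κ₁ κ₂ γ₁⁻¹ γ₂⁻¹ f' (NumberField.discr K).natAbs
      (NumberField.classNumber K) LK G')
    (J : ℤ_[p] →+* PadicComplexInt p)
    (hJ : ∀ x : ℤ_[p], ((J x : PadicComplexInt p) : PadicComplex p) = ((x : ℚ_[p]) : PadicComplex p))
    -- K1′ after D2′: the slack-free product inclusion, and `G G′ ≠ 0`
    (hincl : (WeierstrassCurve.XGr₂.charIdeal (W.baseChange K) p κ₁ κ₂ vbar γ₁ γ₂).map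
          (IwasawaAlgebra₂.toUnr₂ p J) *
        (WeierstrassCurve.XGr₂.charIdeal (W'.baseChange K) p κ₁ κ₂ vbar γ₁ γ₂).map
          (IwasawaAlgebra₂.toUnr₂ p J) ≤ Ideal.span {G * G'})
    (hGG : G * G' ≠ 0) (ε : ℤˣ)
    -- the cyclotomic line: canonical `(κ, γ)` over `ℚ` matching `γ₁`
    (κ : ZpExtension ℚ p) (γ : absoluteGaloisGroup ℚ) (hκ : κ.IsCyclotomic) (hγ : κ.IsTopGenerator γ)
    (hγc : IsCyclotomicVariable p γ)
    (hmatch : ∃ ζ : ℤ_[p]ˣ, IsOfFinOrder ζ ∧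
      GaloisRep.cyclotomicCharacter ℚ p γ * ζ = GaloisRep.cyclotomicCharacter K p γ₁)
    -- minimal models of the `D_K`-twists and their newforms
    (W₂ W₄ : WeierstrassCurve ℚ) [W₂.IsElliptic] [W₂.IsGloballyMinimal] [W₄.IsElliptic]
    [W₄.IsGloballyMinimal] (C₂ C₄ : WeierstrassCurve.VariableChange ℚ)
    (hC₂ : C₂ • W₂ = W.quadraticTwist (NumberField.discr K : ℚ))
    (hC₄ : C₄ • W₄ = W'.quadraticTwist (NumberField.discr K : ℚ))
    {N₂ N₄ : ℕ} [NeZero N₂] [NeZero N₄] (f₂ : CuspForm (Gamma0 N₂) 2) (f₄ : CuspForm (Gamma0 N₄) 2)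
    (hf₂ : IsNewformOf W₂ f₂) (hf₄ : IsNewformOf W₄ f₄)
    -- signed dual data and their generators; Kobayashi `L^ε`-functions
    (D₁ : Kobayashi2003.SignedSelmerDualData W κ γ ε) (D₂ : Kobayashi2003.SignedSelmerDualData W₂ κ γ ε)
    (D₃ : Kobayashi2003.SignedSelmerDualData W' κ γ ε) (D₄ : Kobayashi2003.SignedSelmerDualData W₄ κ γ ε)
    (g₁ g₂ g₃ g₄ L₁ L₂ L₃ L₄ : IwasawaAlgebra p) (hg₁ : D₁.charIdeal = Ideal.span {g₁})
    (hg₂ : D₂.charIdeal = Ideal.span {g₂}) (hg₃ : D₃.charIdeal = Ideal.span {g₃})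
    (hg₄ : D₄.charIdeal = Ideal.span {g₄}) (hL₁ : Kobayashi2003.IsSignedPAdicLFunction f p ε L₁)
    (hL₂ : Kobayashi2003.IsSignedPAdicLFunction f₂ p ε L₂) (hL₃ : Kobayashi2003.IsSignedPAdicLFunction f' p ε L₃)
    (hL₄ : Kobayashi2003.IsSignedPAdicLFunction f₄ p ε L₄) :
    PowerSeries.map J (L₁ * L₂) * PowerSeries.map J (L₃ * L₄) ∣
      PowerSeries.map J (g₁ * g₂) * PowerSeries.map J (g₃ * g₄) := by
  obtain ⟨xi, Lsig, h1, hline⟩ := hP ι W K v vbar κ₁ κ₂ γ₁ γ₂ f hf hN hp hpN hap hK hsplit hv hvbar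
    hne hι hcop hirr hcyc hanti Ω δ Ωp LK G hΩ hδ hLK hG J hJ ε
  obtain ⟨xi', Lsig', h1', hline'⟩ := hP ι W' K v vbar κ₁ κ₂ γ₁ γ₂ f' hf' hN' hp hpN' hap' hK hsplit hv
    hvbar hne hι hcop' hirr' hcyc hanti Ω δ Ωp LK G' hΩ hδ hLK hG' J hJ ε
  have hdvd : Lsig * Lsig' ∣ xi * xi' := mul_dvd_mul_of_span_mul_eq_of_le_span h1 h1' hincl hGG
  obtain ⟨h2, h3⟩ := hline κ γ hκ hγ hγc hmatch W₂ C₂ hC₂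
  obtain ⟨h2', h3'⟩ := hline' κ γ hκ hγ hγc hmatch W₄ C₄ hC₄
  obtain ⟨u, hu, hu_eq⟩ := h3 f₂ hf₂ L₁ L₂ hL₁ hL₂
  obtain ⟨u', hu', hu_eq'⟩ := h3' f₄ hf₄ L₃ L₄ hL₃ hL₄
  exact mul_dvd_mul_of_map_of_dvd_of_eq_unit_mul
    (PowerSeries.map (PowerSeries.constantCoeff (R := PadicComplexInt p))) hdvd
    (h2 D₁ D₂ g₁ g₂ hg₁ hg₂) (h2' D₃ D₄ g₃ g₄ hg₃ hg₄) hu hu' hu_eq hu_eq'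

end Consumability


/-! ### §4. The COORDINATE CLAUSE: a canonical `K`-side generator matches every canonical `ℚ`-side
variable (PROVED; feeds `hmatch` of `map_mul_dvd_map_mul_of_package`) -/

section CoordinateClause

/-- **Matching modulo torsion from the two canonical normalisations.** If `γ ∈ Γ_ℚ` is a canonical
cyclotomic variable (`IsCyclotomicVariable p γ`: `χ_cyc(γ)·ζ′ = 1 + p^{e₀}`) and `γ₁ ∈ Γ_K` satisfies
the `K`-analogue (`χ_cyc,K(γ₁)·ζ₁ = 1 + p^{e₀}` for a torsion unit `ζ₁` — the clause the frame item of
route `SignedBaseChange` is to carry for its generator `γ₁`, HOME/bsd-wall-ty-1/COORDINATE-CLAUSE-gamma1-v1.md),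
then `χ_cyc,ℚ(γ)·ζ = χ_cyc,K(γ₁)` for the torsion unit `ζ = ζ′ζ₁⁻¹`: the two variables `T = γ − 1`,
`T₁ = γ₁ − 1` name the same coordinate on the cyclotomic line. Pure group algebra in `ℤ_pˣ`.
[cite: BurungaleSkinnerTianWan2024, §2.3 (arXiv v2 TeX store p0076 L45–L47: the cyclotomic variable γ of 𝓛_γ(g) read on the line «mod (γ_v − 1)», Prop. 5.19 p0055 L1–L12) (coordinate bookkeeping; nothing asserted)] -/
theorem matching_of_isCyclotomicVariable {p : ℕ} [Fact p.Prime] {K : Type} [Field K] [NumberField K]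
    {γ₁ : absoluteGaloisGroup K} {γ : absoluteGaloisGroup ℚ} (hγ : IsCyclotomicVariable p γ)
    (hγ₁ : ∃ ζ : ℤ_[p]ˣ, IsOfFinOrder ζ ∧
      ((GaloisRep.cyclotomicCharacter K p γ₁ * ζ : ℤ_[p]ˣ) : ℤ_[p]) = (cyclotomicGenerator p : ℤ_[p])) :
    ∃ ζ : ℤ_[p]ˣ, IsOfFinOrder ζ ∧
      GaloisRep.cyclotomicCharacter ℚ p γ * ζ = GaloisRep.cyclotomicCharacter K p γ₁ := by
  obtain ⟨ζ', hζ', h'⟩ := hγ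
  obtain ⟨ζ₁, hζ₁, h₁⟩ := hγ₁
  refine ⟨ζ' * ζ₁⁻¹, hζ'.mul hζ₁.inv, ?_⟩
  have hu : GaloisRep.cyclotomicCharacter ℚ p γ * ζ' = GaloisRep.cyclotomicCharacter K p γ₁ * ζ₁ :=
    Units.ext (h'.trans h₁.symm)
  calc GaloisRep.cyclotomicCharacter ℚ p γ * (ζ' * ζ₁⁻¹)
      = GaloisRep.cyclotomicCharacter ℚ p γ * ζ' * ζ₁⁻¹ := by rw [mul_assoc]
    _ = GaloisRep.cyclotomicCharacter K p γ₁ * ζ₁ * ζ₁⁻¹ := by rw [hu]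
    _ = GaloisRep.cyclotomicCharacter K p γ₁ := by rw [mul_inv_cancel_right]

end CoordinateClause

end Literature.NumberTheory.EllipticCurves.BurungaleSkinnerTianWan2024

end
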